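import Summits.CriticalPhenomena.PercolationContinuityZ3.Theorems.PercNearOneGluingNoHeavyLowerTailSahiOneStepTwoLumpHullMono
import Summits.CriticalPhenomena.PercolationContinuityZ3.Theorems.PercNearOneGluingNoHeavyLowerTailSahiOneStepDualLump
import HarnessLib

/-!
# THE TWO-SIDED LUMPING THEOREM at uniform density: `Cov(A,B) ≥ μ(L)·Cov(A,B | L) + μ(U)·Cov(A,B | U)` for BOTH Hamming balls

Support file (prover prim-ineq-prove-3 gen 50; `--supports stmt-CriticalPhenomena-4575`; memo
`run/shared/lean/prim/prim-ineq-prove-3/FINDING-G50-TWO-SIDED-LUMPING.md`, THEOREM TL and §2).  No definitions, no named facts, no sorries, no `native_decide`.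

**THEOREM (`twoLump_threshold_nonneg_of_const`).**  For a product measure whose density is a constant `P ∈ (0,1)` on the block `F`, all levels
`t ≤ s`, and all increasing `F`-determined events `A, B`, with `T_t = {ω | t ≤ #(F ∩ ω)}`, the lower ball `L = T_tᶜ` and the upper ball `U = T_s`:
`0 ≤ Ψ := (1−μT_t)·μT_s·(μ(T_t∩A∩B) − μ(T_s∩A∩B)) + μT_s·(μA − μ(T_t∩A))(μB − μ(T_t∩B)) + (1−μT_t)·μ(T_s∩A)μ(T_s∩B) − (1−μT_t)·μT_s·μA·μB`,
and `Ψ = μ(L)μ(U)·[Cov(1_A,1_B) − μ(L)·Cov(1_A,1_B ∣ L) − μ(U)·Cov(1_A,1_B ∣ U)]`: collapsing BOTH Hamming balls `{N_F < t}` and `{N_F ≥ s}` to points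
keeps increasing events positively correlated.  The cases `U = ∅` (`s = #F + 1`) and `L = ∅` are gen 21's `osN_threshold_nonneg_of_const` and its dual
`dualLump_threshold_nonneg_of_const`; the two-sided statement is new for `2 ≤ t < s ≤ #F − 1`.

Proof (memo §2): induction on `F`; base layers `t = 1` (the dual theorem) and `s = #F` (the one-sided theorem); otherwise an inner induction on the
compression potential exactly as in gen 21 (`twoLump_compress_le`), and for an `e`-dominant `A` / `e`-dominated `B` the hulls `B ↦ (B^*)_*`
(`T_t`-generated, then generated below `s`: `twoLump_hgen_le`, `twoLump_genb_le`) followed by the two-sided cross-form step `twoLump_nonneg_of_cross` with the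
four drift signs `drift_nonneg_of_dominant`, `drift_nonpos_of_dominated` (lower ball, gen 21) and `upperDrift_nonneg_of_dominant`,
`upperDrift_nonpos_of_dominated` (upper ball, gen 50).
-/

noncomputable section

namespace Summit.CriticalPhenomena.PercolationContinuityZ3.Theorems

namespace SahiOneStep

open MeasureTheory Finset
open Literature.Probability.Percolation (DeterminedBy determinedBy_iff)
open Literature.Probability.LatticeModels (prodBernoulli prodBernoulli_harris)
open Literature.Probability.Percolation.DecisionTree (ind)
open SahiE3Sections (determinedBy_section_insert determinedBy_section_sdiff)
open scoped Classical

variable {ι : Type*} [Fintype ι]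

/-! ## The theorem -/

/-- **THE TWO-SIDED LUMPING THEOREM AT UNIFORM DENSITY** (memo THEOREM TL): for a product measure whose density is a constant `P ∈ (0,1)` on `F`,
all `t ≤ s` and all increasing `F`-determined `A, B`: `0 ≤ Ψ`, i.e. `Cov(1_A,1_B) ≥ μ(N_F < t)·Cov(1_A,1_B ∣ N_F < t) + μ(N_F ≥ s)·Cov(1_A,1_B ∣ N_F ≥ s)`.
[this work] -/
theorem twoLump_threshold_nonneg_of_const (p : ι → unitInterval) {P : ℝ} (hP0 : 0 < P) (hP1 : P < 1) (F : Finset ι)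
    (hpF : ∀ i ∈ F, (p i : ℝ) = P) (t s : ℕ) (hts : t ≤ s) {A B : Set (Set ι)} (hA : IsUpperSet A) (hB : IsUpperSet B)
    (hAF : DeterminedBy A (↑F : Set ι)) (hBF : DeterminedBy B (↑F : Set ι)) :
    0 ≤ (1 - (prodBernoulli p).real {ω : Set ι | t ≤ (F.filter (· ∈ ω)).card}) *
            (prodBernoulli p).real {ω : Set ι | s ≤ (F.filter (· ∈ ω)).card} *
            ((prodBernoulli p).real ({ω : Set ι | t ≤ (F.filter (· ∈ ω)).card} ∩ A ∩ B)
              - (prodBernoulli p).real ({ω : Set ι | s ≤ (F.filter (· ∈ ω)).card} ∩ A ∩ B))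
        + (prodBernoulli p).real {ω : Set ι | s ≤ (F.filter (· ∈ ω)).card} *
            ((prodBernoulli p).real A - (prodBernoulli p).real ({ω : Set ι | t ≤ (F.filter (· ∈ ω)).card} ∩ A)) *
            ((prodBernoulli p).real B - (prodBernoulli p).real ({ω : Set ι | t ≤ (F.filter (· ∈ ω)).card} ∩ B))
        + (1 - (prodBernoulli p).real {ω : Set ι | t ≤ (F.filter (· ∈ ω)).card}) *
            (prodBernoulli p).real ({ω : Set ι | s ≤ (F.filter (· ∈ ω)).card} ∩ A) *
            (prodBernoulli p).real ({ω : Set ι | s ≤ (F.filter (· ∈ ω)).card} ∩ B)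
        - (1 - (prodBernoulli p).real {ω : Set ι | t ≤ (F.filter (· ∈ ω)).card}) *
            (prodBernoulli p).real {ω : Set ι | s ≤ (F.filter (· ∈ ω)).card} *
            (prodBernoulli p).real A * (prodBernoulli p).real B := by
  induction F using Finset.induction_on generalizing t s A B with
  | empty =>
    cases t with
    | zero => rw [twoLump_zero_left]
    | succ t =>
      obtain ⟨s', rfl⟩ : ∃ s', s = s' + 1 := ⟨s - 1, by omega⟩
      rw [threshold_empty_succ, threshold_empty_succ]
      simp
  | insert e F heF ih =>
    have hpF' : ∀ i ∈ F, (p i : ℝ) = P := fun i hi => hpF i (Finset.mem_insert_of_mem hi)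
    have hp01 : ∀ i ∈ F, 0 < (p i : ℝ) ∧ (p i : ℝ) < 1 := fun i hi => by rw [hpF' i hi]; exact ⟨hP0, hP1⟩
    have hp01G : ∀ i ∈ insert e F, 0 < (p i : ℝ) ∧ (p i : ℝ) < 1 := fun i hi => by rw [hpF i hi]; exact ⟨hP0, hP1⟩
    cases t with
    | zero => rw [twoLump_zero_left]
    | succ t =>
      obtain ⟨s, rfl⟩ : ∃ s', s = s' + 1 := ⟨s - 1, by omega⟩
      have hts' : t ≤ s := by omega
      -- `s + 1 > #(insert e F)`: the upper ball is empty
      by_cases hsbig : (insert e F).card < s + 1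
      · rw [threshold_eq_empty_of_card_lt (insert e F) hsbig]
        simp
      push Not at hsbig
      have heG : e ∈ insert e F := Finset.mem_insert_self e F
      have hHup : IsUpperSet {ω : Set ι | t + 1 ≤ ((insert e F).filter (· ∈ ω)).card} := isUpperSet_threshold _ _
      have hHG : DeterminedBy {ω : Set ι | t + 1 ≤ ((insert e F).filter (· ∈ ω)).card} (↑(insert e F) : Set ι) :=
        determinedBy_threshold _ _
      have hUup : IsUpperSet {ω : Set ι | s + 1 ≤ ((insert e F).filter (· ∈ ω)).card} := isUpperSet_threshold _ _
      -- base layer `s + 1 = #(insert e F)`: the one-sided theorem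
      by_cases hstop : s + 1 = (insert e F).card
      · by_cases hAne : A = ∅
        · subst hAne
          simp
        by_cases hBne : B = ∅
        · subst hBne
          simp
        have hUA : {ω : Set ι | s + 1 ≤ ((insert e F).filter (· ∈ ω)).card} ∩ A = {ω : Set ι | s + 1 ≤ ((insert e F).filter (· ∈ ω)).card} :=
          Set.inter_eq_left.2 (hstop ▸ threshold_card_subset hA hAF (Set.nonempty_iff_ne_empty.2 hAne))
        have hUB : {ω : Set ι | s + 1 ≤ ((insert e F).filter (· ∈ ω)).card} ∩ B = {ω : Set ι | s + 1 ≤ ((insert e F).filter (· ∈ ω)).card} :=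
          Set.inter_eq_left.2 (hstop ▸ threshold_card_subset hB hBF (Set.nonempty_iff_ne_empty.2 hBne))
        have hos := osN_threshold_nonneg_of_const p hP0 hP1 (insert e F) hpF (t + 1) hA hB hAF hBF
        rw [osN_ind_ind] at hos
        have hu : 0 ≤ (prodBernoulli p).real {ω : Set ι | s + 1 ≤ ((insert e F).filter (· ∈ ω)).card} := measureReal_nonneg
        have key : (1 - (prodBernoulli p).real {ω : Set ι | t + 1 ≤ ((insert e F).filter (· ∈ ω)).card}) *
                (prodBernoulli p).real {ω : Set ι | s + 1 ≤ ((insert e F).filter (· ∈ ω)).card} *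
                ((prodBernoulli p).real ({ω : Set ι | t + 1 ≤ ((insert e F).filter (· ∈ ω)).card} ∩ A ∩ B)
                  - (prodBernoulli p).real ({ω : Set ι | s + 1 ≤ ((insert e F).filter (· ∈ ω)).card} ∩ A ∩ B))
            + (prodBernoulli p).real {ω : Set ι | s + 1 ≤ ((insert e F).filter (· ∈ ω)).card} *
                ((prodBernoulli p).real A - (prodBernoulli p).real ({ω : Set ι | t + 1 ≤ ((insert e F).filter (· ∈ ω)).card} ∩ A)) *
                ((prodBernoulli p).real B - (prodBernoulli p).real ({ω : Set ι | t + 1 ≤ ((insert e F).filter (· ∈ ω)).card} ∩ B))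
            + (1 - (prodBernoulli p).real {ω : Set ι | t + 1 ≤ ((insert e F).filter (· ∈ ω)).card}) *
                (prodBernoulli p).real ({ω : Set ι | s + 1 ≤ ((insert e F).filter (· ∈ ω)).card} ∩ A) *
                (prodBernoulli p).real ({ω : Set ι | s + 1 ≤ ((insert e F).filter (· ∈ ω)).card} ∩ B)
            - (1 - (prodBernoulli p).real {ω : Set ι | t + 1 ≤ ((insert e F).filter (· ∈ ω)).card}) *
                (prodBernoulli p).real {ω : Set ι | s + 1 ≤ ((insert e F).filter (· ∈ ω)).card} *
                (prodBernoulli p).real A * (prodBernoulli p).real B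
            = (prodBernoulli p).real {ω : Set ι | s + 1 ≤ ((insert e F).filter (· ∈ ω)).card} *
              ((prodBernoulli p).real ({ω : Set ι | t + 1 ≤ ((insert e F).filter (· ∈ ω)).card} ∩ A) *
                  (prodBernoulli p).real ({ω : Set ι | t + 1 ≤ ((insert e F).filter (· ∈ ω)).card} ∩ B)
                + (1 - (prodBernoulli p).real {ω : Set ι | t + 1 ≤ ((insert e F).filter (· ∈ ω)).card}) *
                  (prodBernoulli p).real ({ω : Set ι | t + 1 ≤ ((insert e F).filter (· ∈ ω)).card} ∩ A ∩ B)
                + (prodBernoulli p).real {ω : Set ι | t + 1 ≤ ((insert e F).filter (· ∈ ω)).card} * (prodBernoulli p).real A * (prodBernoulli p).real B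
                - (prodBernoulli p).real ({ω : Set ι | t + 1 ≤ ((insert e F).filter (· ∈ ω)).card} ∩ A) * (prodBernoulli p).real B
                - (prodBernoulli p).real ({ω : Set ι | t + 1 ≤ ((insert e F).filter (· ∈ ω)).card} ∩ B) * (prodBernoulli p).real A) := by
          rw [hUA, hUB]; ring
        rw [key]
        exact mul_nonneg hu hos
      have hsF : s + 1 ≤ F.card := by rw [Finset.card_insert_of_notMem heF] at hsbig hstop; omega
      have hcoe : (↑(insert e F) : Set ι) \ {e} = ↑F := by
        ext i
        simp only [Set.mem_sdiff, Finset.coe_insert, Set.mem_insert_iff, Finset.mem_coe, Set.mem_singleton_iff]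
        constructor
        · rintro ⟨h | h, hne⟩
          · exact absurd h hne
          · exact h
        · intro h
          exact ⟨Or.inr h, fun hie => heF (hie ▸ h)⟩
      -- base layer `t + 1 = 1`: the dual theorem
      rcases Nat.eq_zero_or_pos t with rfl | htpos
      · by_cases hAu : A = Set.univ
        · subst hAu
          have key : (1 - (prodBernoulli p).real {ω : Set ι | 0 + 1 ≤ ((insert e F).filter (· ∈ ω)).card}) *
                (prodBernoulli p).real {ω : Set ι | s + 1 ≤ ((insert e F).filter (· ∈ ω)).card} *
                ((prodBernoulli p).real ({ω : Set ι | 0 + 1 ≤ ((insert e F).filter (· ∈ ω)).card} ∩ Set.univ ∩ B)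
                  - (prodBernoulli p).real ({ω : Set ι | s + 1 ≤ ((insert e F).filter (· ∈ ω)).card} ∩ Set.univ ∩ B))
            + (prodBernoulli p).real {ω : Set ι | s + 1 ≤ ((insert e F).filter (· ∈ ω)).card} *
                ((prodBernoulli p).real Set.univ - (prodBernoulli p).real ({ω : Set ι | 0 + 1 ≤ ((insert e F).filter (· ∈ ω)).card} ∩ Set.univ)) *
                ((prodBernoulli p).real B - (prodBernoulli p).real ({ω : Set ι | 0 + 1 ≤ ((insert e F).filter (· ∈ ω)).card} ∩ B))
            + (1 - (prodBernoulli p).real {ω : Set ι | 0 + 1 ≤ ((insert e F).filter (· ∈ ω)).card}) *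
                (prodBernoulli p).real ({ω : Set ι | s + 1 ≤ ((insert e F).filter (· ∈ ω)).card} ∩ Set.univ) *
                (prodBernoulli p).real ({ω : Set ι | s + 1 ≤ ((insert e F).filter (· ∈ ω)).card} ∩ B)
            - (1 - (prodBernoulli p).real {ω : Set ι | 0 + 1 ≤ ((insert e F).filter (· ∈ ω)).card}) *
                (prodBernoulli p).real {ω : Set ι | s + 1 ≤ ((insert e F).filter (· ∈ ω)).card} *
                (prodBernoulli p).real Set.univ * (prodBernoulli p).real B = 0 := by
            simp only [Set.inter_univ, probReal_univ]; ring
          rw [key]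
        by_cases hBu : B = Set.univ
        · subst hBu
          have key : (1 - (prodBernoulli p).real {ω : Set ι | 0 + 1 ≤ ((insert e F).filter (· ∈ ω)).card}) *
                (prodBernoulli p).real {ω : Set ι | s + 1 ≤ ((insert e F).filter (· ∈ ω)).card} *
                ((prodBernoulli p).real ({ω : Set ι | 0 + 1 ≤ ((insert e F).filter (· ∈ ω)).card} ∩ A ∩ Set.univ)
                  - (prodBernoulli p).real ({ω : Set ι | s + 1 ≤ ((insert e F).filter (· ∈ ω)).card} ∩ A ∩ Set.univ))
            + (prodBernoulli p).real {ω : Set ι | s + 1 ≤ ((insert e F).filter (· ∈ ω)).card} *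
                ((prodBernoulli p).real A - (prodBernoulli p).real ({ω : Set ι | 0 + 1 ≤ ((insert e F).filter (· ∈ ω)).card} ∩ A)) *
                ((prodBernoulli p).real Set.univ - (prodBernoulli p).real ({ω : Set ι | 0 + 1 ≤ ((insert e F).filter (· ∈ ω)).card} ∩ Set.univ))
            + (1 - (prodBernoulli p).real {ω : Set ι | 0 + 1 ≤ ((insert e F).filter (· ∈ ω)).card}) *
                (prodBernoulli p).real ({ω : Set ι | s + 1 ≤ ((insert e F).filter (· ∈ ω)).card} ∩ A) *
                (prodBernoulli p).real ({ω : Set ι | s + 1 ≤ ((insert e F).filter (· ∈ ω)).card} ∩ Set.univ)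
            - (1 - (prodBernoulli p).real {ω : Set ι | 0 + 1 ≤ ((insert e F).filter (· ∈ ω)).card}) *
                (prodBernoulli p).real {ω : Set ι | s + 1 ≤ ((insert e F).filter (· ∈ ω)).card} *
                (prodBernoulli p).real A * (prodBernoulli p).real Set.univ = 0 := by
            simp only [Set.inter_univ, probReal_univ]; ring
          rw [key]
        -- neither event is everything: both avoid the empty pattern, so `T_1 ∩ X = X`
        have hT1X : ∀ X : Set (Set ι), IsUpperSet X → DeterminedBy X (↑(insert e F) : Set ι) → X ≠ Set.univ →
            {ω : Set ι | 0 + 1 ≤ ((insert e F).filter (· ∈ ω)).card} ∩ X = X := by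
          intro X hX hXG hXu
          refine Set.inter_eq_right.2 fun ω hω => ?_
          simp only [Set.mem_setOf_eq]
          by_contra h
          exact hXu (eq_univ_of_mem_of_filter_card_eq_zero hX hXG hω (by omega))
        have eA := hT1X A hA hAF hAu
        have eB := hT1X B hB hBF hBu
        have hdual := dualLump_threshold_nonneg_of_const p hP0 hP1 (insert e F) hpF (s + 1) hA hB hAF hBF
        have ediff : (prodBernoulli p).real ((A ∩ B) \ {ω : Set ι | s + 1 ≤ ((insert e F).filter (· ∈ ω)).card}) =
            (prodBernoulli p).real (A ∩ B) - (prodBernoulli p).real ({ω : Set ι | s + 1 ≤ ((insert e F).filter (· ∈ ω)).card} ∩ A ∩ B) := by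
          have h := measureReal_inter_add_sdiff (μ := prodBernoulli p) (s := A ∩ B)
            (t := {ω : Set ι | s + 1 ≤ ((insert e F).filter (· ∈ ω)).card}) MeasurableSet.of_discrete
          have hc : A ∩ B ∩ {ω : Set ι | s + 1 ≤ ((insert e F).filter (· ∈ ω)).card} =
              {ω : Set ι | s + 1 ≤ ((insert e F).filter (· ∈ ω)).card} ∩ A ∩ B := by
            ext ω; simp only [Set.mem_inter_iff]; tauto
          rw [hc] at h
          linarith
        rw [ediff, Set.inter_comm A {ω : Set ι | s + 1 ≤ ((insert e F).filter (· ∈ ω)).card},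
          Set.inter_comm B {ω : Set ι | s + 1 ≤ ((insert e F).filter (· ∈ ω)).card}] at hdual
        have hl : 0 ≤ 1 - (prodBernoulli p).real {ω : Set ι | 0 + 1 ≤ ((insert e F).filter (· ∈ ω)).card} := sub_nonneg.2 measureReal_le_one
        have key : (1 - (prodBernoulli p).real {ω : Set ι | 0 + 1 ≤ ((insert e F).filter (· ∈ ω)).card}) *
                (prodBernoulli p).real {ω : Set ι | s + 1 ≤ ((insert e F).filter (· ∈ ω)).card} *
                ((prodBernoulli p).real ({ω : Set ι | 0 + 1 ≤ ((insert e F).filter (· ∈ ω)).card} ∩ A ∩ B)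
                  - (prodBernoulli p).real ({ω : Set ι | s + 1 ≤ ((insert e F).filter (· ∈ ω)).card} ∩ A ∩ B))
            + (prodBernoulli p).real {ω : Set ι | s + 1 ≤ ((insert e F).filter (· ∈ ω)).card} *
                ((prodBernoulli p).real A - (prodBernoulli p).real ({ω : Set ι | 0 + 1 ≤ ((insert e F).filter (· ∈ ω)).card} ∩ A)) *
                ((prodBernoulli p).real B - (prodBernoulli p).real ({ω : Set ι | 0 + 1 ≤ ((insert e F).filter (· ∈ ω)).card} ∩ B))
            + (1 - (prodBernoulli p).real {ω : Set ι | 0 + 1 ≤ ((insert e F).filter (· ∈ ω)).card}) *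
                (prodBernoulli p).real ({ω : Set ι | s + 1 ≤ ((insert e F).filter (· ∈ ω)).card} ∩ A) *
                (prodBernoulli p).real ({ω : Set ι | s + 1 ≤ ((insert e F).filter (· ∈ ω)).card} ∩ B)
            - (1 - (prodBernoulli p).real {ω : Set ι | 0 + 1 ≤ ((insert e F).filter (· ∈ ω)).card}) *
                (prodBernoulli p).real {ω : Set ι | s + 1 ≤ ((insert e F).filter (· ∈ ω)).card} *
                (prodBernoulli p).real A * (prodBernoulli p).real B
            = (1 - (prodBernoulli p).real {ω : Set ι | 0 + 1 ≤ ((insert e F).filter (· ∈ ω)).card}) *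
              ((prodBernoulli p).real {ω : Set ι | s + 1 ≤ ((insert e F).filter (· ∈ ω)).card} *
                  ((prodBernoulli p).real (A ∩ B) - (prodBernoulli p).real ({ω : Set ι | s + 1 ≤ ((insert e F).filter (· ∈ ω)).card} ∩ A ∩ B))
                + (prodBernoulli p).real ({ω : Set ι | s + 1 ≤ ((insert e F).filter (· ∈ ω)).card} ∩ A) *
                  (prodBernoulli p).real ({ω : Set ι | s + 1 ≤ ((insert e F).filter (· ∈ ω)).card} ∩ B)
                - (prodBernoulli p).real {ω : Set ι | s + 1 ≤ ((insert e F).filter (· ∈ ω)).card} * (prodBernoulli p).real A * (prodBernoulli p).real B) := by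
          rw [eA, eB]; ring
        rw [key]
        exact mul_nonneg hl hdual
      -- main step: `1 ≤ t`, `t + 1 ≤ s + 1 ≤ #F`; inner induction on the compression potential
      suffices key : ∀ (m : ℕ) (A B : Set (Set ι)), IsUpperSet A → IsUpperSet B →
          DeterminedBy A (↑(insert e F) : Set ι) → DeterminedBy B (↑(insert e F) : Set ι) →
          #((insert e F).powerset.filter fun S : Finset ι => (((↑S : Set ι) ∈ A) ∧ e ∉ S)) +
            #((insert e F).powerset.filter fun S : Finset ι => (((↑S : Set ι) ∈ B) ∧ e ∈ S)) = m →
          0 ≤ (1 - (prodBernoulli p).real {ω : Set ι | t + 1 ≤ ((insert e F).filter (· ∈ ω)).card}) *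
              (prodBernoulli p).real {ω : Set ι | s + 1 ≤ ((insert e F).filter (· ∈ ω)).card} *
              ((prodBernoulli p).real ({ω : Set ι | t + 1 ≤ ((insert e F).filter (· ∈ ω)).card} ∩ A ∩ B)
                - (prodBernoulli p).real ({ω : Set ι | s + 1 ≤ ((insert e F).filter (· ∈ ω)).card} ∩ A ∩ B))
          + (prodBernoulli p).real {ω : Set ι | s + 1 ≤ ((insert e F).filter (· ∈ ω)).card} *
              ((prodBernoulli p).real A - (prodBernoulli p).real ({ω : Set ι | t + 1 ≤ ((insert e F).filter (· ∈ ω)).card} ∩ A)) *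
              ((prodBernoulli p).real B - (prodBernoulli p).real ({ω : Set ι | t + 1 ≤ ((insert e F).filter (· ∈ ω)).card} ∩ B))
          + (1 - (prodBernoulli p).real {ω : Set ι | t + 1 ≤ ((insert e F).filter (· ∈ ω)).card}) *
              (prodBernoulli p).real ({ω : Set ι | s + 1 ≤ ((insert e F).filter (· ∈ ω)).card} ∩ A) *
              (prodBernoulli p).real ({ω : Set ι | s + 1 ≤ ((insert e F).filter (· ∈ ω)).card} ∩ B)
          - (1 - (prodBernoulli p).real {ω : Set ι | t + 1 ≤ ((insert e F).filter (· ∈ ω)).card}) *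
              (prodBernoulli p).real {ω : Set ι | s + 1 ≤ ((insert e F).filter (· ∈ ω)).card} *
              (prodBernoulli p).real A * (prodBernoulli p).real B from
        key _ A B hA hB hAF hBF rfl
      intro m
      induction m using Nat.strong_induction_on with
      | _ m ihm =>
      intro A B hA hB hAF hBF hm
      by_cases hdom : (∀ j ∈ F, ∀ ω ∈ A, e ∉ ω → j ∈ ω → (ω \ {j}) ∪ {e} ∈ A) ∧
          (∀ j ∈ F, ∀ ω ∈ B, e ∈ ω → j ∉ ω → (ω \ {e}) ∪ {j} ∈ B)
      · -- dominated pair: hulls of `B` (lower cogeneration, then generation below `s + 1`) and the cross-form step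
        obtain ⟨hdomA, hdomB⟩ := hdom
        have hB1up := isUpperSet_hgen {ω : Set ι | t + 1 ≤ ((insert e F).filter (· ∈ ω)).card} B
        have hB1G := determinedBy_hgen hHG hBF
        refine le_trans ?_ (twoLump_hgen_le p (insert e F) (show t + 1 ≤ s + 1 by omega) hA hB)
        have hB2up := isUpperSet_genb {ω : Set ι | ∀ ω' : Set ι, ω ⊆ ω' → ω' ∈ {ω : Set ι | t + 1 ≤ ((insert e F).filter (· ∈ ω)).card} → ω' ∈ B}
          {ω : Set ι | ((insert e F).filter (· ∈ ω)).card < s + 1}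
        have hB2G := determinedBy_genb hB1G (s + 1)
        refine le_trans ?_ (twoLump_genb_le p (insert e F) (show t + 1 ≤ s + 1 by omega) hA hB1up)
        -- properties of the double hull
        have hB2dom : ∀ ω ∈ {ω : Set ι | ∃ z : Set ι, z ⊆ ω ∧ z ∈ {ω : Set ι | ∀ ω' : Set ι, ω ⊆ ω' → ω' ∈ {ω : Set ι | t + 1 ≤ ((insert e F).filter (· ∈ ω)).card} → ω' ∈ B} ∧ z ∈ {ω : Set ι | ((insert e F).filter (· ∈ ω)).card < s + 1}}, e ∈ ω → ∀ j ∈ F, j ∉ ω → (ω \ {e}) ∪ {j} ∈ {ω : Set ι | ∃ z : Set ι, z ⊆ ω ∧ z ∈ {ω : Set ι | ∀ ω' : Set ι, ω ⊆ ω' → ω' ∈ {ω : Set ι | t + 1 ≤ ((insert e F).filter (· ∈ ω)).card} → ω' ∈ B} ∧ z ∈ {ω : Set ι | ((insert e F).filter (· ∈ ω)).card < s + 1}} :=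
          fun ω hω heω j hj hjω => dominated_genb heG (Finset.mem_insert_of_mem hj) (s + 1)
            (dominated_hgen heG (Finset.mem_insert_of_mem hj) (fun h => heF (h ▸ hj)) (t + 1) (hdomB j hj)) ω hω heω hjω
        have hB2gen : ∀ ω : Set ι, (∀ ω' : Set ι, ω ⊆ ω' → t + 1 ≤ ((insert e F).filter (· ∈ ω')).card → ω' ∈ {ω : Set ι | ∃ z : Set ι, z ⊆ ω ∧ z ∈ {ω : Set ι | ∀ ω' : Set ι, ω ⊆ ω' → ω' ∈ {ω : Set ι | t + 1 ≤ ((insert e F).filter (· ∈ ω)).card} → ω' ∈ B} ∧ z ∈ {ω : Set ι | ((insert e F).filter (· ∈ ω)).card < s + 1}}) → ω ∈ {ω : Set ι | ∃ z : Set ι, z ⊆ ω ∧ z ∈ {ω : Set ι | ∀ ω' : Set ι, ω ⊆ ω' → ω' ∈ {ω : Set ι | t + 1 ≤ ((insert e F).filter (· ∈ ω)).card} → ω' ∈ B} ∧ z ∈ {ω : Set ι | ((insert e F).filter (· ∈ ω)).card < s + 1}} :=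
          hgen_genb hB1up (fun ω hω => by
              have h1 : ¬ ((insert e F).filter (· ∈ ω)).card < s + 1 := hω
              show t + 1 ≤ ((insert e F).filter (· ∈ ω)).card
              omega)
            (fun ω h ω' hsub hH' => h ω' hsub hH' ω' subset_rfl hH')
        have hB2below := genBelow_genb (insert e F)
          {ω : Set ι | ∀ ω' : Set ι, ω ⊆ ω' → ω' ∈ {ω : Set ι | t + 1 ≤ ((insert e F).filter (· ∈ ω)).card} → ω' ∈ B} s
        refine twoLump_nonneg_of_cross p heF t s A {ω : Set ι | ∃ z : Set ι, z ⊆ ω ∧ z ∈ {ω : Set ι | ∀ ω' : Set ι, ω ⊆ ω' → ω' ∈ {ω : Set ι | t + 1 ≤ ((insert e F).filter (· ∈ ω)).card} → ω' ∈ B} ∧ z ∈ {ω : Set ι | ((insert e F).filter (· ∈ ω)).card < s + 1}} ?_ ?_ ?_ ?_ ?_ ?_ ?_ ?_ ?_ ?_ ?_ ?_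
        · exact ih hpF' t s hts' (isUpperSet_section_insert hA e) (isUpperSet_section_insert hB2up e)
            (hcoe ▸ determinedBy_section_insert hAF e) (hcoe ▸ determinedBy_section_insert hB2G e)
        · exact ih hpF' (t + 1) (s + 1) (by omega) (isUpperSet_section_sdiff hA e) (isUpperSet_section_sdiff hB2up e)
            (hcoe ▸ determinedBy_section_sdiff hAF e) (hcoe ▸ determinedBy_section_sdiff hB2G e)
        · exact real_threshold_lt_one p F hp01 t htpos
        · exact real_threshold_lt_one p F hp01 (t + 1) (by omega)
        · exact real_threshold_pos p F hp01 (by omega)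
        · exact real_threshold_pos p F hp01 hsF
        · exact measureReal_mono (section_sdiff_subset_section_insert hA e)
        · exact measureReal_mono (section_sdiff_subset_section_insert hB2up e)
        · have h := drift_nonneg_of_dominant p heF (show t ≤ F.card by omega) hp01 hA hAF
            (fun ω hω heω j hj hjω => hdomA j hj ω hω heω hjω)
          rw [section_insert_threshold heF, section_sdiff_threshold heF] at h
          exact h
        · have h := drift_nonpos_of_dominated p heF t hB2up hB2G hB2dom hB2gen
          rw [section_insert_threshold heF, section_sdiff_threshold heF] at h
          exact h
        · have h := upperDrift_nonneg_of_dominant p heF hp01 hA hAF (fun ω hω heω j hj hjω => hdomA j hj ω hω heω hjω) s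
          rw [Set.inter_comm {ω : Set ι | ω \ {e} ∈ A}, Set.inter_comm {ω : Set ι | insert e ω ∈ A}] at h
          exact h
        · have h := upperDrift_nonpos_of_dominated p heF s hB2up hB2G hB2dom hB2below
          rw [Set.inter_comm {ω : Set ι | insert e ω ∈ {ω : Set ι | ∃ z : Set ι, z ⊆ ω ∧ z ∈ {ω : Set ι | ∀ ω' : Set ι, ω ⊆ ω' → ω' ∈ {ω : Set ι | t + 1 ≤ ((insert e F).filter (· ∈ ω)).card} → ω' ∈ B} ∧ z ∈ {ω : Set ι | ((insert e F).filter (· ∈ ω)).card < s + 1}}}, Set.inter_comm {ω : Set ι | ω \ {e} ∈ {ω : Set ι | ∃ z : Set ι, z ⊆ ω ∧ z ∈ {ω : Set ι | ∀ ω' : Set ι, ω ⊆ ω' → ω' ∈ {ω : Set ι | t + 1 ≤ ((insert e F).filter (· ∈ ω)).card} → ω' ∈ B} ∧ z ∈ {ω : Set ι | ((insert e F).filter (· ∈ ω)).card < s + 1}}}] at h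
          exact h
      · -- a trade fails: compress along that pair of coordinates; the potential drops
        have hex : ∃ j ∈ F, (∃ ω ∈ A, e ∉ ω ∧ j ∈ ω ∧ (ω \ {j}) ∪ {e} ∉ A) ∨ (∃ ω ∈ B, e ∈ ω ∧ j ∉ ω ∧ (ω \ {e}) ∪ {j} ∉ B) := by
          rw [not_and_or] at hdom
          rcases hdom with h | h
          · push Not at h
            obtain ⟨j, hj, ω, hω, heω, hjω, hno⟩ := h
            exact ⟨j, hj, Or.inl ⟨ω, hω, heω, hjω, hno⟩⟩
          · push Not at h
            obtain ⟨j, hj, ω, hω, heω, hjω, hno⟩ := h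
            exact ⟨j, hj, Or.inr ⟨ω, hω, heω, hjω, hno⟩⟩
        obtain ⟨j, hjF, hwit⟩ := hex
        have hej : e ≠ j := fun h => heF (h ▸ hjF)
        have hjG : j ∈ insert e F := Finset.mem_insert_of_mem hjF
        have hpej : p e = p j := Subtype.ext (by rw [hpF e heG, hpF j hjG])
        -- the compressions of `A` towards `e` and of `B` towards `j`
        -- (introduced as opaque sets, characterised by their membership)
        obtain ⟨CA, hCAdef⟩ : ∃ CA : Set (Set ι), CA = {ω : Set ι | (ω ∈ A ∧ {x : ι | Equiv.swap e j x ∈ ω} ∈ A) ∨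
          (e ∈ ω ∧ j ∉ ω ∧ (ω ∈ A ∨ {x : ι | Equiv.swap e j x ∈ ω} ∈ A))} := ⟨_, rfl⟩
        obtain ⟨CB, hCBdef⟩ : ∃ CB : Set (Set ι), CB = {ω : Set ι | (ω ∈ B ∧ {x : ι | Equiv.swap e j x ∈ ω} ∈ B) ∨
          (j ∈ ω ∧ e ∉ ω ∧ (ω ∈ B ∨ {x : ι | Equiv.swap e j x ∈ ω} ∈ B))} := ⟨_, rfl⟩
        have hCA : ∀ ω : Set ι, ω ∈ CA ↔ (ω ∈ A ∧ {x : ι | Equiv.swap e j x ∈ ω} ∈ A) ∨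
            (e ∈ ω ∧ j ∉ ω ∧ (ω ∈ A ∨ {x : ι | Equiv.swap e j x ∈ ω} ∈ A)) := fun ω => by rw [hCAdef]; exact Iff.rfl
        have hCB : ∀ ω : Set ι, ω ∈ CB ↔ (ω ∈ B ∧ {x : ι | Equiv.swap e j x ∈ ω} ∈ B) ∨
            (j ∈ ω ∧ e ∉ ω ∧ (ω ∈ B ∨ {x : ι | Equiv.swap e j x ∈ ω} ∈ B)) := fun ω => by rw [hCBdef]; exact Iff.rfl
        have hCB' : ∀ ω : Set ι, ω ∈ CB ↔ (ω ∈ B ∧ {x : ι | Equiv.swap j e x ∈ ω} ∈ B) ∨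
            (j ∈ ω ∧ e ∉ ω ∧ (ω ∈ B ∨ {x : ι | Equiv.swap j e x ∈ ω} ∈ B)) := by
          intro ω; rw [Equiv.swap_comm j e]; exact hCB ω
        have hCAup : IsUpperSet CA := isUpperSet_of_compress hej hA hCA
        have hCBup : IsUpperSet CB := isUpperSet_of_compress hej.symm hB hCB'
        have hCAG : DeterminedBy CA (↑(insert e F) : Set ι) := determinedBy_of_compress heG hjG hAF hCA
        have hCBG : DeterminedBy CB (↑(insert e F) : Set ι) := determinedBy_of_compress hjG heG hBF hCB'
        -- the potential drops
        have hsubA := filter_pat_compress_subset (G := insert e F) hCA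
        have hsubB := filter_pat_compress_subset' (G := insert e F) hCB
        have hlt : #((insert e F).powerset.filter fun S : Finset ι => (((↑S : Set ι) ∈ CA) ∧ e ∉ S)) +
            #((insert e F).powerset.filter fun S : Finset ι => (((↑S : Set ι) ∈ CB) ∧ e ∈ S)) < m := by
          rcases hwit with ⟨ω, hωA, heω, hjω, hno⟩ | ⟨ω, hωB, heω, hjω, hno⟩
          · have hS₀e : e ∉ ((↑((insert e F).filter (· ∈ ω)) : Set ι)) := fun h => by
              rw [Finset.mem_coe, Finset.mem_filter] at h; exact heω h.2
            have hS₀j : j ∈ ((↑((insert e F).filter (· ∈ ω)) : Set ι)) := by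
              rw [Finset.mem_coe, Finset.mem_filter]; exact ⟨hjG, hjω⟩
            have hS₀A : (insert e F).filter (· ∈ ω) ∈ (insert e F).powerset.filter (fun S : Finset ι => (((↑S : Set ι) ∈ A) ∧ e ∉ S)) := by
              rw [Finset.mem_filter]
              exact ⟨Finset.mem_powerset.2 (Finset.filter_subset _ _), (coe_filter_mem_iff hAF ω).2 hωA,
                fun h => heω (Finset.mem_filter.1 h).2⟩
            have hS₀C : (insert e F).filter (· ∈ ω) ∉ (insert e F).powerset.filter (fun S : Finset ι => (((↑S : Set ι) ∈ CA) ∧ e ∉ S)) := by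
              intro h
              rw [Finset.mem_filter] at h
              rcases (hCA _).1 h.2.1 with ⟨_, hσ⟩ | ⟨he', _, _⟩
              · rw [swapSet_eq_trade hS₀e hS₀j] at hσ
                have htr := trade_inter_eq (coe_filter_inter_eq (insert e F) ω) j e
                exact hno (((determinedBy_iff _ _).1 hAF _ _ htr).1 hσ)
              · exact hS₀e he'
            have h1 := Finset.card_lt_card ((Finset.ssubset_iff_of_subset hsubA).2 ⟨_, hS₀A, hS₀C⟩)
            have h2 := Finset.card_le_card hsubB
            omega
          · have hS₀e : e ∈ ((↑((insert e F).filter (· ∈ ω)) : Set ι)) := by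
              rw [Finset.mem_coe, Finset.mem_filter]; exact ⟨heG, heω⟩
            have hS₀j : j ∉ ((↑((insert e F).filter (· ∈ ω)) : Set ι)) := fun h => by
              rw [Finset.mem_coe, Finset.mem_filter] at h; exact hjω h.2
            have hS₀B : (insert e F).filter (· ∈ ω) ∈ (insert e F).powerset.filter (fun S : Finset ι => (((↑S : Set ι) ∈ B) ∧ e ∈ S)) := by
              rw [Finset.mem_filter]
              exact ⟨Finset.mem_powerset.2 (Finset.filter_subset _ _), (coe_filter_mem_iff hBF ω).2 hωB,
                Finset.mem_filter.2 ⟨heG, heω⟩⟩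
            have hS₀C : (insert e F).filter (· ∈ ω) ∉ (insert e F).powerset.filter (fun S : Finset ι => (((↑S : Set ι) ∈ CB) ∧ e ∈ S)) := by
              intro h
              rw [Finset.mem_filter] at h
              rcases (hCB _).1 h.2.1 with ⟨_, hσ⟩ | ⟨_, he', _⟩
              · rw [swapSet_eq_trade' hS₀e hS₀j] at hσ
                have htr := trade_inter_eq (coe_filter_inter_eq (insert e F) ω) e j
                exact hno (((determinedBy_iff _ _).1 hBF _ _ htr).1 hσ)
              · exact he' hS₀e
            have h1 := Finset.card_le_card hsubA
            have h2 := Finset.card_lt_card ((Finset.ssubset_iff_of_subset hsubB).2 ⟨_, hS₀B, hS₀C⟩)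
            omega
        calc (0 : ℝ) ≤ (1 - (prodBernoulli p).real {ω : Set ι | t + 1 ≤ ((insert e F).filter (· ∈ ω)).card}) *
                  (prodBernoulli p).real {ω : Set ι | s + 1 ≤ ((insert e F).filter (· ∈ ω)).card} *
                  ((prodBernoulli p).real ({ω : Set ι | t + 1 ≤ ((insert e F).filter (· ∈ ω)).card} ∩ CA ∩ CB)
                    - (prodBernoulli p).real ({ω : Set ι | s + 1 ≤ ((insert e F).filter (· ∈ ω)).card} ∩ CA ∩ CB))
              + (prodBernoulli p).real {ω : Set ι | s + 1 ≤ ((insert e F).filter (· ∈ ω)).card} *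
                  ((prodBernoulli p).real CA - (prodBernoulli p).real ({ω : Set ι | t + 1 ≤ ((insert e F).filter (· ∈ ω)).card} ∩ CA)) *
                  ((prodBernoulli p).real CB - (prodBernoulli p).real ({ω : Set ι | t + 1 ≤ ((insert e F).filter (· ∈ ω)).card} ∩ CB))
              + (1 - (prodBernoulli p).real {ω : Set ι | t + 1 ≤ ((insert e F).filter (· ∈ ω)).card}) *
                  (prodBernoulli p).real ({ω : Set ι | s + 1 ≤ ((insert e F).filter (· ∈ ω)).card} ∩ CA) *
                  (prodBernoulli p).real ({ω : Set ι | s + 1 ≤ ((insert e F).filter (· ∈ ω)).card} ∩ CB)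
              - (1 - (prodBernoulli p).real {ω : Set ι | t + 1 ≤ ((insert e F).filter (· ∈ ω)).card}) *
                  (prodBernoulli p).real {ω : Set ι | s + 1 ≤ ((insert e F).filter (· ∈ ω)).card} *
                  (prodBernoulli p).real CA * (prodBernoulli p).real CB := ihm _ hlt CA CB hCAup hCBup hCAG hCBG rfl
          _ ≤ _ := twoLump_compress_le p heG hjG hpej (show t + 1 ≤ s + 1 by omega) hAF hBF hCA hCB

end SahiOneStep

end Summit.CriticalPhenomena.PercolationContinuityZ3.Theorems
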